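import Summits.Parity.GeneralizedHardyLittlewood.Theses.ParityLeakOneFifth
import Summits.Parity.GeneralizedHardyLittlewood.Theorems.GeneralizedHardyLittlewoodDimOnePosition
import HarnessLib

/-!
# Line `birth` (BC3 birth skeleton) for the crux `TwinLowerDensityToGHL` of route `ParityLeakOneFifth` (stmt-Parity-18380)

Published as `Lines/birth_ParityLeakOneFifth.lean` (card `Lines/birth_ParityLeakOneFifth.md`): the workfile directory `Cruxes/TwinLowerDensityToGHL/` is
SHARED with the sibling crux of the same decl name (stmt-Parity-18665, route `ParityWeightedChenSwitching`),
whose registrar already holds `Lines/birth.lean`; the two cruxes are the same proposition by `Iff.rfl`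
(tree `Theorems.TwinLowerDensityToGHL.Negative.parityLeakOneFifth_twinLowerDensityToGHL_iff`) but distinct items.

The crux is the route's DECLARED RESIDUAL `R := TwinLowerDensity → GeneralizedHardyLittlewood`
(positive lower density of twin primes on the Hardy–Littlewood scale ⇒ Green–Tao Conj. 1.2, all `d`,
all complexities).  Kernel facts governing it (all in the tree):

* `GeneralizedHardyLittlewood ↔ GeneralizedHardyLittlewoodDimOne`
  (`Summit.Parity.GeneralizedHardyLittlewood.generalizedHardyLittlewood_iff_generalizedHardyLittlewoodDimOne`,
  imported; `←` is the PROVED fibration lemma `Theses.DicksonFibration.Assembly_holds`, `→` is `d := 1`).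
  So the open content of `R` is `DimOne` (stmt-Parity-0819) given `T`.
* `¬R ↔ T ∧ ¬GHL`, `R → PairsToGHL` (domination of stmt-Parity-9389), and `R ∧ T ⇒` bounded Siegel zeros
  modulo Matomäki–Merikoski (`Theorems/TwinLowerDensityToGHL/Negative/TwinLowerDensityToGHLCost.lean`):
  any usable proof of `R` is a Landau–Siegel-type theorem.
* The hypothesis `T = TwinLowerDensity` is INERT for everything in `DimOne`: it is a one-sided,
  constant-free bound (`π₂(x) ≥ c·x/log²x`, any `c > 0`) for ONE fixed system `(n, n+2)`; even with
  Elliott–Halberstam-level distribution Bombieri's asymptotic sieve leaves the twin asymptotic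
  undetermined up to the parity factor `1 + δ`, `δ ∈ [-1, 1]`, and `T` only excludes `δ = -1`
  (Bombieri1976; `Literature.Barriers.Parity.SelbergParityBarrier`).  `T` is itself a shadow of the
  `t = 2`, `Φ = (n, n + 2)` instance of `stub_boundedDickson` below (Λ-weighted twin asymptotic with
  `𝔖₂ > 0`; tree `twin_lower_bound_of_pairAsymptotic_two` does the conversion from the `h = 2` pair
  asymptotic), exactly as `PairsHL` is inert in the kernel-equivalent analysis of crux stmt-Parity-9389
  (`Cruxes/PairsToGHL/STRATEGY-CENSUS.md` §0).

The skeleton therefore names the content of `R` along the hub's established fault line for `DimOne`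
(three axes: `k ≥ 3` tuples, slopes `aᵢ ≠ 1`, shift-uniformity `|bᵢ| ≤ L·N`; census of stmt-Parity-9389):

* `stub_boundedDickson` — Dickson–Hardy–Littlewood for every FIXED non-degenerate one-dimensional
  system (all `t ≥ 1`, all slopes, bounded shifts): VERBATIM the shared hub node `BoundedDickson`
  (stmt-Parity-13151, `Theses.TwinMinorArcs.BoundedDickson`; also hypothesis `hB` of the landed
  `Theorems.EngineToGHL.SlopedInputs.engineToGHL_of_boundedDickson_of_shiftLift` and the conclusion of
  `boundedDickson_of_ladderInputs`).  Siegel-inert (fixed systems are unobstructed in the illusory world,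
  Matomäki–Merikoski Cor. 1.1); parity-hard (contains twins, Sophie Germain, prime `k`-tuples in progressions).
* `stub_shiftLift` — the SHIFT LIFT `BoundedDickson → DimOne` (stmt-Parity-0819 verbatim): pointwise
  Dickson ⇒ shift-uniform Dickson (Goldbach `(n, M − n)` for every even `M ≤ LN`, pairs `(n, n + h)`
  uniformly in `h ≤ LN`).  VERBATIM the residual stub `stub_shiftLift` registered on crux stmt-Parity-9389
  (`Cruxes/PairsToGHL/Lines/sloped_ladder.lean`; = hypothesis `hLift` of the landed
  `engineToGHL_of_boundedDickson_of_shiftLift`) = `TwinMinorArcs.ResidualLift` (b).  Landau–Siegel-complete: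
  under `Literature.Barriers.Parity.UnboundedSiegelZeros` its hypothesis survives while its conclusion fails
  at `h = 2q`, `N = q^{10}` (`not_generalizedHardyLittlewoodDimOne_of_unboundedSiegelZeros`, imported).

LAYOUT (A12 skeleton-audit shape, as in the registered `Cruxes/Thesis/Lines/birth.lean` of
HubbardSuperconductivity): §1 the two stub STATEMENTS as reducible `Prop` abbreviations
`Statement.stub_<name>` (obligation nodes BY NAME — the admissible hypotheses of the composition; an
anonymous written-out hypothesis is read as `skeleton.extra-hypothesis` by `#h21_check_skeleton`);
§2 the two sorried stubs `stub_<name>` with their signatures WRITTEN OUT (= the registered text,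
self-contained over tree vocabulary; the ONLY sorries of the file); §3 the sorry-free composition
`TwinLowerDensityToGHL_of : Statement.stub_boundedDickson → Statement.stub_shiftLift → TwinLowerDensityToGHL`
(crux BY NAME), an `example` re-checking the literal written-out form, the in-kernel identity of the
lift's conclusion with `GeneralizedHardyLittlewoodDimOne` (stmt-Parity-0819), and
`TwinLowerDensityToGHL_of_stubs : TwinLowerDensityToGHL` (the crux from the stubs).

HONESTY NOTE (route re-audit bin HONEST). `T` is DISCARDED by the composition, deliberately: `R` is the
route's declared residual "everything in `GHL` beyond `T`" (route header RANKED CRUXES #4) and `T` is inert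
in substance (above).  The stubs are therefore a BRIDGE SPLIT `B ∧ (B → DimOne)` of `DimOne ↔ GHL ⇒ R` with
a SUBSTANTIVE, OPEN waist `B = BoundedDickson` that does not give `DimOne` on its own (shift lift missing;
Siegel-separated) — not a split of `R` into consequences of `R` (typing the first stub as `T → B` would make
`T` formally load-bearing at the price of a costume node `B`-modulo-`T` shared with nothing; the sibling
registration on stmt-Parity-18665 takes that other road with waist `PairsHL`).  This skeleton does not make
`R` easier; it types its content as two SHARED hub nodes so that (i) any proof of `BoundedDickson` (13151)
or of the shift lift elsewhere closes the corresponding stub here by signature, and (ii) the Landau–Siegel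
certificate is carried by ONE named stub.  Neither stub is a proof target of route ParityLeakOneFifth
(whose content is the sieve-theoretic core PintzDensity ∧ CalibratedE1 ⇒ E1NonSaturation ⇒ TwinLowerDensity).
BC3 probes (registrar folder `bc/birth_probes.lean`, attached as evidence on stmt-Parity-18380): for each stub
`X`, `X → TwinLowerDensityToGHL` and `X → GeneralizedHardyLittlewood` by `first | exact? | simpa | aesop`
FAIL (6/6; recorded in the line card `Lines/birth_ParityLeakOneFifth.md`).  Sources: GreenTao2010 Conj. 1.2
and §1 (fibration remark); Dickson1904; HardyLittlewood1923; Bombieri1976; MatomakiMerikoski2023 Thm 1.3 /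
Cor. 1.1; FordMaynard2024.
-/

namespace Summit.Parity.GeneralizedHardyLittlewood.Cruxes.TwinLowerDensityToGHL.BirthParityLeakOneFifth

/-! ### §1 The two stub statements (obligation nodes by name; verbatim the signatures of §2) -/

namespace Statement

/-- Statement of `stub_boundedDickson` (= hub node `BoundedDickson`, stmt-Parity-13151, verbatim); see the
docstring of `stub_boundedDickson` in §2.  Reducible, so the composition sees through it. [folklore] -/
abbrev stub_boundedDickson : Prop :=
    ∀ (t : ℕ) (Φ : Fin t → Literature.NumberTheory.Sieve.AffLinForm 1), 1 ≤ t → Literature.NumberTheory.Sieve.IsNondegenerateSystem Φ → ∀ ε : ℝ, 0 < ε → ∃ N₀ : ℕ, ∀ N : ℕ, N₀ ≤ N → ∀ K : Set (Fin 1 → ℝ), Convex ℝ K → K ⊆ Literature.NumberTheory.Sieve.realBox 1 N → |Literature.NumberTheory.Sieve.vonMangoldtSum Φ K N - Literature.NumberTheory.Sieve.archFactor Φ K * Literature.NumberTheory.Sieve.singularProduct Φ| ≤ ε * N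

/-- Statement of `stub_shiftLift` (`BoundedDickson → DimOne`, stmt-Parity-13151 → stmt-Parity-0819, both
verbatim); see the docstring of `stub_shiftLift` in §2.  Reducible, so the composition sees through it. [folklore] -/
abbrev stub_shiftLift : Prop :=
    (∀ (t : ℕ) (Φ : Fin t → Literature.NumberTheory.Sieve.AffLinForm 1), 1 ≤ t → Literature.NumberTheory.Sieve.IsNondegenerateSystem Φ → ∀ ε : ℝ, 0 < ε → ∃ N₀ : ℕ, ∀ N : ℕ, N₀ ≤ N → ∀ K : Set (Fin 1 → ℝ), Convex ℝ K → K ⊆ Literature.NumberTheory.Sieve.realBox 1 N → |Literature.NumberTheory.Sieve.vonMangoldtSum Φ K N - Literature.NumberTheory.Sieve.archFactor Φ K * Literature.NumberTheory.Sieve.singularProduct Φ| ≤ ε * N) →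
      ∀ (t L : ℕ), 1 ≤ t → ∀ ε : ℝ, 0 < ε → ∃ N₀ : ℕ, ∀ N : ℕ, N₀ ≤ N → ∀ Ψ : Fin t → Literature.NumberTheory.Sieve.AffLinForm 1, Literature.NumberTheory.Sieve.IsNondegenerateSystem Ψ → Literature.NumberTheory.Sieve.affLinSize Ψ N ≤ L → ∀ K : Set (Fin 1 → ℝ), Convex ℝ K → K ⊆ Literature.NumberTheory.Sieve.realBox 1 N → |Literature.NumberTheory.Sieve.vonMangoldtSum Ψ K N - Literature.NumberTheory.Sieve.archFactor Ψ K * Literature.NumberTheory.Sieve.singularProduct Ψ| ≤ ε * (N : ℝ)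

end Statement

/-! ### §2 The two stubs (sorried; signatures written out = the registered text; the ONLY sorries of this file) -/

/-- **stub_boundedDickson — Dickson–Hardy–Littlewood for every FIXED one-dimensional system** (VERBATIM
the hub node `BoundedDickson`, stmt-Parity-13151): for every non-degenerate `Φ : Fin t → AffLinForm 1`
(`t ≥ 1`) and `ε > 0`, eventually in `N`, for every convex `K ⊆ [−N, N]`,
`|Σ_{n ∈ K} Πᵢ Λ(φᵢ(n)) − β_∞ Π_p β_p| ≤ ε N`.  Bounded shifts only (`Φ` fixed before `N`): prime
`k`-tuples with slopes, twins, Sophie Germain; NOT Goldbach, NOT shift-uniform.  Open (parity-hard: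
`Literature.Barriers.Parity.SelbergParityBarrier`, `PrimePairParity`); Siegel-inert.  The crux
hypothesis `TwinLowerDensity` is a one-sided shadow of its instance `Φ = (n, n + 2)`.  NOT a proof
target of this route.  Sources: Dickson1904, HardyLittlewood1923, GreenTao2010 Conj. 1.2. [folklore] -/
theorem stub_boundedDickson :
    ∀ (t : ℕ) (Φ : Fin t → Literature.NumberTheory.Sieve.AffLinForm 1), 1 ≤ t → Literature.NumberTheory.Sieve.IsNondegenerateSystem Φ → ∀ ε : ℝ, 0 < ε → ∃ N₀ : ℕ, ∀ N : ℕ, N₀ ≤ N → ∀ K : Set (Fin 1 → ℝ), Convex ℝ K → K ⊆ Literature.NumberTheory.Sieve.realBox 1 N → |Literature.NumberTheory.Sieve.vonMangoldtSum Φ K N - Literature.NumberTheory.Sieve.archFactor Φ K * Literature.NumberTheory.Sieve.singularProduct Φ| ≤ ε * N := by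
  sorry

/-- **stub_shiftLift — the SHIFT LIFT `BoundedDickson → DimOne`** (VERBATIM the residual stub of
`Cruxes/PairsToGHL/Lines/sloped_ladder.lean`; hypothesis = stmt-Parity-13151, conclusion =
stmt-Parity-0819 = `GeneralizedHardyLittlewoodDimOne`): pointwise Dickson ⇒ Dickson UNIFORMLY over
`‖Ψ‖_N ≤ L` (shifts `|bᵢ| ≤ L·N`: Goldbach `(n, M − n)` for every even `M ≤ LN`, pairs `(n, n + h)`
uniformly in `h ≤ LN`).  Landau–Siegel-complete: under `UnboundedSiegelZeros` the hypothesis is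
unobstructed (Matomäki–Merikoski Cor. 1.1) while the conclusion fails at `h = 2q`, `N = q^{10}`
(`not_generalizedHardyLittlewoodDimOne_of_unboundedSiegelZeros`).  GHL-hard; NOT a proof target.
Sources: GreenTao2010 Conj. 1.2, MatomakiMerikoski2023 Thm 1.3 / Cor. 1.1, GoldstonSuriajaya2021. [folklore] -/
theorem stub_shiftLift :
    (∀ (t : ℕ) (Φ : Fin t → Literature.NumberTheory.Sieve.AffLinForm 1), 1 ≤ t → Literature.NumberTheory.Sieve.IsNondegenerateSystem Φ → ∀ ε : ℝ, 0 < ε → ∃ N₀ : ℕ, ∀ N : ℕ, N₀ ≤ N → ∀ K : Set (Fin 1 → ℝ), Convex ℝ K → K ⊆ Literature.NumberTheory.Sieve.realBox 1 N → |Literature.NumberTheory.Sieve.vonMangoldtSum Φ K N - Literature.NumberTheory.Sieve.archFactor Φ K * Literature.NumberTheory.Sieve.singularProduct Φ| ≤ ε * N) →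
      ∀ (t L : ℕ), 1 ≤ t → ∀ ε : ℝ, 0 < ε → ∃ N₀ : ℕ, ∀ N : ℕ, N₀ ≤ N → ∀ Ψ : Fin t → Literature.NumberTheory.Sieve.AffLinForm 1, Literature.NumberTheory.Sieve.IsNondegenerateSystem Ψ → Literature.NumberTheory.Sieve.affLinSize Ψ N ≤ L → ∀ K : Set (Fin 1 → ℝ), Convex ℝ K → K ⊆ Literature.NumberTheory.Sieve.realBox 1 N → |Literature.NumberTheory.Sieve.vonMangoldtSum Ψ K N - Literature.NumberTheory.Sieve.archFactor Ψ K * Literature.NumberTheory.Sieve.singularProduct Ψ| ≤ ε * (N : ℝ) := by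
  sorry

/-! ### §3 Composition: the crux modulo the two registered stubs (no sorry below this line) -/

/-- **Composition of line `birth`.** The crux BY NAME from the two stub statements BY NAME:
`stub_shiftLift` applied to `stub_boundedDickson` is `DimOne` (= `GeneralizedHardyLittlewoodDimOne`,
definitionally), and the PROVED fibration lemma
(`generalizedHardyLittlewood_iff_generalizedHardyLittlewoodDimOne.mpr`) gives Green–Tao's Conjecture 1.2
in all dimensions.  The crux hypothesis `TwinLowerDensity` is introduced and not used (inert; module
docstring, HONESTY NOTE). [cite: GreenTao2010, Conj. 1.2 and §1] -/
theorem TwinLowerDensityToGHL_of :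
    Statement.stub_boundedDickson → Statement.stub_shiftLift →
      Summit.Parity.GeneralizedHardyLittlewood.Theses.ParityLeakOneFifth.TwinLowerDensityToGHL := by
  intro hB hL _hT
  exact Summit.Parity.GeneralizedHardyLittlewood.generalizedHardyLittlewood_iff_generalizedHardyLittlewoodDimOne.mpr
    (hL hB)

/-- The literal form `⟨stub_boundedDickson-signature⟩ → ⟨stub_shiftLift-signature⟩ → TwinLowerDensityToGHL`,
written out and kernel-checked against `TwinLowerDensityToGHL_of` (an `example`, so it is not a second named
candidate for the audit). -/
example :
    (∀ (t : ℕ) (Φ : Fin t → Literature.NumberTheory.Sieve.AffLinForm 1), 1 ≤ t → Literature.NumberTheory.Sieve.IsNondegenerateSystem Φ → ∀ ε : ℝ, 0 < ε → ∃ N₀ : ℕ, ∀ N : ℕ, N₀ ≤ N → ∀ K : Set (Fin 1 → ℝ), Convex ℝ K → K ⊆ Literature.NumberTheory.Sieve.realBox 1 N → |Literature.NumberTheory.Sieve.vonMangoldtSum Φ K N - Literature.NumberTheory.Sieve.archFactor Φ K * Literature.NumberTheory.Sieve.singularProduct Φ| ≤ ε * N) →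
    ((∀ (t : ℕ) (Φ : Fin t → Literature.NumberTheory.Sieve.AffLinForm 1), 1 ≤ t → Literature.NumberTheory.Sieve.IsNondegenerateSystem Φ → ∀ ε : ℝ, 0 < ε → ∃ N₀ : ℕ, ∀ N : ℕ, N₀ ≤ N → ∀ K : Set (Fin 1 → ℝ), Convex ℝ K → K ⊆ Literature.NumberTheory.Sieve.realBox 1 N → |Literature.NumberTheory.Sieve.vonMangoldtSum Φ K N - Literature.NumberTheory.Sieve.archFactor Φ K * Literature.NumberTheory.Sieve.singularProduct Φ| ≤ ε * N) →
      ∀ (t L : ℕ), 1 ≤ t → ∀ ε : ℝ, 0 < ε → ∃ N₀ : ℕ, ∀ N : ℕ, N₀ ≤ N → ∀ Ψ : Fin t → Literature.NumberTheory.Sieve.AffLinForm 1, Literature.NumberTheory.Sieve.IsNondegenerateSystem Ψ → Literature.NumberTheory.Sieve.affLinSize Ψ N ≤ L → ∀ K : Set (Fin 1 → ℝ), Convex ℝ K → K ⊆ Literature.NumberTheory.Sieve.realBox 1 N → |Literature.NumberTheory.Sieve.vonMangoldtSum Ψ K N - Literature.NumberTheory.Sieve.archFactor Ψ K * Literature.NumberTheory.Sieve.singularProduct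 Ψ| ≤ ε * (N : ℝ)) →
    Summit.Parity.GeneralizedHardyLittlewood.Theses.ParityLeakOneFifth.TwinLowerDensityToGHL :=
  TwinLowerDensityToGHL_of

/-- The lift's conclusion IS the named open statement `GeneralizedHardyLittlewoodDimOne` (stmt-Parity-0819,
`@[conjecture]`, `Theorems/GeneralizedHardyLittlewoodDimOne.lean`), in the kernel. -/
example :
    Statement.stub_shiftLift ↔
      (Statement.stub_boundedDickson → Summit.Parity.GeneralizedHardyLittlewood.GeneralizedHardyLittlewoodDimOne) :=
  Iff.rfl

/-- The stubs jointly give the summit conjunct itself (bridge split with the open waist `BoundedDickson`;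
`T` inert): recorded so that no reader mistakes the split for a decomposition of `R` into consequences of `R`. -/
example :
    Statement.stub_boundedDickson → Statement.stub_shiftLift → _root_.GeneralizedHardyLittlewood :=
  fun hB hL =>
    Summit.Parity.GeneralizedHardyLittlewood.generalizedHardyLittlewood_iff_generalizedHardyLittlewoodDimOne.mpr
      (hL hB)

/-- The crux from the two stubs BY NAME (registered form; depends on `sorryAx` only through
`stub_boundedDickson` and `stub_shiftLift`). [folklore] -/
theorem TwinLowerDensityToGHL_of_stubs :
    Summit.Parity.GeneralizedHardyLittlewood.Theses.ParityLeakOneFifth.TwinLowerDensityToGHL :=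
  TwinLowerDensityToGHL_of stub_boundedDickson stub_shiftLift

end Summit.Parity.GeneralizedHardyLittlewood.Cruxes.TwinLowerDensityToGHL.BirthParityLeakOneFifth
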